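import Mathlib
import Summits.ValiantsHypothesis.ValiantsHypothesis.Theorems.BarrierLeverPartitionMinorsHitByVPHiddenStatesSymbolicStep

/-!
# F⁺ certificate compiled to a kernel proof (val-np-p3 g10, lab/cert2lean.py): 2^[3] ∪ {{3},{0,3},{1,3}} vs B_2([4]), h = 4

Helper file (`--supports stmt-ValiantsHypothesis-19717`; line `hidden-states`, lane `stub_universalJoinWide`; prover seat val-np-p3 gen 10). DEMO of the
certificate pipeline of memo val-np-p3 g10 §10–§11: the lower family 𝒰 = 2^{[3]} ∪ {{3},{0,3},{1,3}} (11 sets, NOT containing the ball B₂([4]):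
the pair {2,3} is missing) against the bare Hamming ball B₂([4]) on 4 states (11 members, zero slack). `lab/fitting2.py` found an F⁺ tree of
hyperplane cuts; `lab/cert2lean.py` emitted this file: each `good_nodeN` is one application of `SymbJoin.symGood_of_split_enum` (or the base
case `symGood_of_lonely`), all side conditions closed by `decide` / `norm_num`; `certified` = the `∃ tx, det ≠ 0` conclusion of the line stubs
for this (u, e), obtained with no linear algebra over ℂ. Bookkeeping defs `u_nodeN`, `e_nodeN` (the explicit configurations); four linters are
switched off because the emitted tactic blocks are uniform (some simp lemmas are unused at some nodes). WHAT THIS IS NOT: a toy instance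
(h = 4, star range) — it demonstrates the certificate → kernel route, nothing about the node at h ≥ 18; item 19717 OPEN.
-/

set_option linter.dupNamespace false
set_option linter.unusedSimpArgs false
set_option linter.unnecessarySeqFocus false
set_option linter.unusedTactic false
set_option linter.unreachableTactic false
set_option maxRecDepth 2000

namespace Summit.ValiantsHypothesis.ValiantsHypothesis.Theorems.BarrierLever.HiddenStates.SymbJoin.Cert

open Finset Matrix MvPolynomial SymbJoin

noncomputable section
/-- rows of node1 -/
def u_node1 : Fin 11 → Finset (Fin 4) := ![(∅ : Finset (Fin 4)), ({0} : Finset (Fin 4)), ({1} : Finset (Fin 4)), ({0, 1} : Finset (Fin 4)), ({2} : Finset (Fin 4)), ({0, 2} : Finset (Fin 4)), ({1, 2} : Finset (Fin 4)), ({0, 1, 2} : Finset (Fin 4)), ({3} : Finset (Fin 4)), ({0, 3} : Finset (Fin 4)), ({1, 3} : Finset (Fin 4))]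

/-- columns of node1 -/
def e_node1 : Fin 11 → Fin 1 × Finset (Fin 4) := ![((⟨0, by decide⟩ : Fin 1), (∅ : Finset (Fin 4))), ((⟨0, by decide⟩ : Fin 1), ({0} : Finset (Fin 4))), ((⟨0, by decide⟩ : Fin 1), ({1} : Finset (Fin 4))), ((⟨0, by decide⟩ : Fin 1), ({0, 1} : Finset (Fin 4))), ((⟨0, by decide⟩ : Fin 1), ({2} : Finset (Fin 4))), ((⟨0, by decide⟩ : Fin 1), ({0, 2} : Finset (Fin 4))), ((⟨0, by decide⟩ : Fin 1), ({1, 2} : Finset (Fin 4))), ((⟨0, by decide⟩ : Fin 1), ({3} : Finset (Fin 4))), ((⟨0, by decide⟩ : Fin 1), ({0, 3} : Finset (Fin 4))), ((⟨0, by decide⟩ : Fin 1), ({1, 3} : Finset (Fin 4))), ((⟨0, by decide⟩ : Fin 1), ({2, 3} : Finset (Fin 4)))]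

/-- rows of node2 -/
def u_node2 : Fin 7 → Finset (Fin 4) := ![(∅ : Finset (Fin 4)), ({0} : Finset (Fin 4)), ({1} : Finset (Fin 4)), ({0, 1} : Finset (Fin 4)), ({3} : Finset (Fin 4)), ({0, 3} : Finset (Fin 4)), ({1, 3} : Finset (Fin 4))]

/-- columns of node2 -/
def e_node2 : Fin 7 → Fin 1 × Finset (Fin 4) := ![((⟨0, by decide⟩ : Fin 1), (∅ : Finset (Fin 4))), ((⟨0, by decide⟩ : Fin 1), ({1} : Finset (Fin 4))), ((⟨0, by decide⟩ : Fin 1), ({2} : Finset (Fin 4))), ((⟨0, by decide⟩ : Fin 1), ({1, 2} : Finset (Fin 4))), ((⟨0, by decide⟩ : Fin 1), ({3} : Finset (Fin 4))), ((⟨0, by decide⟩ : Fin 1), ({1, 3} : Finset (Fin 4))), ((⟨0, by decide⟩ : Fin 1), ({2, 3} : Finset (Fin 4)))]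

/-- rows of node3 -/
def u_node3 : Fin 4 → Finset (Fin 4) := ![(∅ : Finset (Fin 4)), ({1} : Finset (Fin 4)), ({3} : Finset (Fin 4)), ({1, 3} : Finset (Fin 4))]

/-- columns of node3 -/
def e_node3 : Fin 4 → Fin 1 × Finset (Fin 4) := ![((⟨0, by decide⟩ : Fin 1), (∅ : Finset (Fin 4))), ((⟨0, by decide⟩ : Fin 1), ({2} : Finset (Fin 4))), ((⟨0, by decide⟩ : Fin 1), ({3} : Finset (Fin 4))), ((⟨0, by decide⟩ : Fin 1), ({2, 3} : Finset (Fin 4)))]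

/-- rows of node4 -/
def u_node4 : Fin 2 → Finset (Fin 4) := ![(∅ : Finset (Fin 4)), ({3} : Finset (Fin 4))]

/-- columns of node4 -/
def e_node4 : Fin 2 → Fin 1 × Finset (Fin 4) := ![((⟨0, by decide⟩ : Fin 1), (∅ : Finset (Fin 4))), ((⟨0, by decide⟩ : Fin 1), ({3} : Finset (Fin 4)))]

/-- rows of node5 -/
def u_node5 : Fin 1 → Finset (Fin 4) := ![(∅ : Finset (Fin 4))]

/-- columns of node5 -/
def e_node5 : Fin 1 → Fin 1 × Finset (Fin 4) := ![((⟨0, by decide⟩ : Fin 1), (∅ : Finset (Fin 4)))]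

/-- leaf node5: lonely columns (one per piece), generically good. -/
theorem good_node5 : symDet u_node5 e_node5 ≠ 0 :=
  symGood_of_lonely u_node5 (by decide) e_node5 (by decide)

/-- rows of node6 -/
def u_node6 : Fin 1 → Finset (Fin 4) := ![(∅ : Finset (Fin 4))]

/-- columns of node6 -/
def e_node6 : Fin 1 → Fin 1 × Finset (Fin 4) := ![((⟨0, by decide⟩ : Fin 1), ({3} : Finset (Fin 4)))]

/-- leaf node6: lonely columns (one per piece), generically good. -/
theorem good_node6 : symDet u_node6 e_node6 ≠ 0 :=
  symGood_of_lonely u_node6 (by decide) e_node6 (by decide)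

/-- node node4: cut at coordinate 3; deletion side = node5, link side = node6. -/
theorem good_node4 : symDet u_node4 e_node4 ≠ 0 := by
  have h0 : symDet (fun j : Fin 1 => u_node4 (![(0 : Fin 2)] j)) (fun j => e_node4 (![(0 : Fin 2)] j)) ≠ 0 := by
    convert good_node5 using 2
    all_goals (funext j; fin_cases j <;> decide)
  have h1 : symDet (fun j : Fin 1 => (u_node4 (![(1 : Fin 2)] j)).erase (3 : Fin 4)) (fun j => e_node4 (![(1 : Fin 2)] j)) ≠ 0 := by
    convert good_node6 using 2
    all_goals (funext j; fin_cases j <;> decide)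
  refine symGood_of_split_enum u_node4 e_node4 (3 : Fin 4) (fun p => ((![0 ] : Fin 1 → ℤ) p : ℂ))
    (fun p q => ((![![0, 0, 0, -1]] : Fin 1 → Fin 4 → ℤ) p q : ℂ)) (by norm_num) ![(0 : Fin 2)] ![(1 : Fin 2)] ![(0 : Fin 2)] ![(1 : Fin 2)]
    (by decide) (by decide) (by decide) (by decide) ?_ ?_ h0 h1
  · intro j; fin_cases j <;> simp [xi, e_node4, Finset.sum_insert, Finset.sum_pair] <;> norm_num
  · intro j; fin_cases j <;> simp [xi, e_node4, Finset.sum_insert, Finset.sum_pair] <;> norm_num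

/-- rows of node7 -/
def u_node7 : Fin 2 → Finset (Fin 4) := ![(∅ : Finset (Fin 4)), ({3} : Finset (Fin 4))]

/-- columns of node7 -/
def e_node7 : Fin 2 → Fin 1 × Finset (Fin 4) := ![((⟨0, by decide⟩ : Fin 1), ({2} : Finset (Fin 4))), ((⟨0, by decide⟩ : Fin 1), ({2, 3} : Finset (Fin 4)))]

/-- rows of node8 -/
def u_node8 : Fin 1 → Finset (Fin 4) := ![(∅ : Finset (Fin 4))]

/-- columns of node8 -/
def e_node8 : Fin 1 → Fin 1 × Finset (Fin 4) := ![((⟨0, by decide⟩ : Fin 1), ({2} : Finset (Fin 4)))]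

/-- leaf node8: lonely columns (one per piece), generically good. -/
theorem good_node8 : symDet u_node8 e_node8 ≠ 0 :=
  symGood_of_lonely u_node8 (by decide) e_node8 (by decide)

/-- rows of node9 -/
def u_node9 : Fin 1 → Finset (Fin 4) := ![(∅ : Finset (Fin 4))]

/-- columns of node9 -/
def e_node9 : Fin 1 → Fin 1 × Finset (Fin 4) := ![((⟨0, by decide⟩ : Fin 1), ({2, 3} : Finset (Fin 4)))]

/-- leaf node9: lonely columns (one per piece), generically good. -/
theorem good_node9 : symDet u_node9 e_node9 ≠ 0 :=
  symGood_of_lonely u_node9 (by decide) e_node9 (by decide)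

/-- node node7: cut at coordinate 3; deletion side = node8, link side = node9. -/
theorem good_node7 : symDet u_node7 e_node7 ≠ 0 := by
  have h0 : symDet (fun j : Fin 1 => u_node7 (![(0 : Fin 2)] j)) (fun j => e_node7 (![(0 : Fin 2)] j)) ≠ 0 := by
    convert good_node8 using 2
    all_goals (funext j; fin_cases j <;> decide)
  have h1 : symDet (fun j : Fin 1 => (u_node7 (![(1 : Fin 2)] j)).erase (3 : Fin 4)) (fun j => e_node7 (![(1 : Fin 2)] j)) ≠ 0 := by
    convert good_node9 using 2
    all_goals (funext j; fin_cases j <;> decide)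
  refine symGood_of_split_enum u_node7 e_node7 (3 : Fin 4) (fun p => ((![0 ] : Fin 1 → ℤ) p : ℂ))
    (fun p q => ((![![0, 0, 0, -1]] : Fin 1 → Fin 4 → ℤ) p q : ℂ)) (by norm_num) ![(0 : Fin 2)] ![(1 : Fin 2)] ![(0 : Fin 2)] ![(1 : Fin 2)]
    (by decide) (by decide) (by decide) (by decide) ?_ ?_ h0 h1
  · intro j; fin_cases j <;> simp [xi, e_node7, Finset.sum_insert, Finset.sum_pair] <;> norm_num
  · intro j; fin_cases j <;> simp [xi, e_node7, Finset.sum_insert, Finset.sum_pair] <;> norm_num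

/-- node node3: cut at coordinate 1; deletion side = node4, link side = node7. -/
theorem good_node3 : symDet u_node3 e_node3 ≠ 0 := by
  have h0 : symDet (fun j : Fin 2 => u_node3 (![(0 : Fin 4), (2 : Fin 4)] j)) (fun j => e_node3 (![(0 : Fin 4), (2 : Fin 4)] j)) ≠ 0 := by
    convert good_node4 using 2
    all_goals (funext j; fin_cases j <;> decide)
  have h1 : symDet (fun j : Fin 2 => (u_node3 (![(1 : Fin 4), (3 : Fin 4)] j)).erase (1 : Fin 4)) (fun j => e_node3 (![(1 : Fin 4), (3 : Fin 4)] j)) ≠ 0 := by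
    convert good_node7 using 2
    all_goals (funext j; fin_cases j <;> decide)
  refine symGood_of_split_enum u_node3 e_node3 (1 : Fin 4) (fun p => ((![0 ] : Fin 1 → ℤ) p : ℂ))
    (fun p q => ((![![0, 0, -1, 0]] : Fin 1 → Fin 4 → ℤ) p q : ℂ)) (by norm_num) ![(0 : Fin 4), (2 : Fin 4)] ![(1 : Fin 4), (3 : Fin 4)] ![(0 : Fin 4), (2 : Fin 4)] ![(1 : Fin 4), (3 : Fin 4)]
    (by decide) (by decide) (by decide) (by decide) ?_ ?_ h0 h1
  · intro j; fin_cases j <;> simp [xi, e_node3, Finset.sum_insert, Finset.sum_pair] <;> norm_num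
  · intro j; fin_cases j <;> simp [xi, e_node3, Finset.sum_insert, Finset.sum_pair] <;> norm_num

/-- rows of node10 -/
def u_node10 : Fin 3 → Finset (Fin 4) := ![(∅ : Finset (Fin 4)), ({1} : Finset (Fin 4)), ({3} : Finset (Fin 4))]

/-- columns of node10 -/
def e_node10 : Fin 3 → Fin 1 × Finset (Fin 4) := ![((⟨0, by decide⟩ : Fin 1), ({1} : Finset (Fin 4))), ((⟨0, by decide⟩ : Fin 1), ({1, 2} : Finset (Fin 4))), ((⟨0, by decide⟩ : Fin 1), ({1, 3} : Finset (Fin 4)))]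

/-- rows of node11 -/
def u_node11 : Fin 2 → Finset (Fin 4) := ![(∅ : Finset (Fin 4)), ({3} : Finset (Fin 4))]

/-- columns of node11 -/
def e_node11 : Fin 2 → Fin 1 × Finset (Fin 4) := ![((⟨0, by decide⟩ : Fin 1), ({1} : Finset (Fin 4))), ((⟨0, by decide⟩ : Fin 1), ({1, 3} : Finset (Fin 4)))]

/-- rows of node12 -/
def u_node12 : Fin 1 → Finset (Fin 4) := ![(∅ : Finset (Fin 4))]

/-- columns of node12 -/
def e_node12 : Fin 1 → Fin 1 × Finset (Fin 4) := ![((⟨0, by decide⟩ : Fin 1), ({1} : Finset (Fin 4)))]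

/-- leaf node12: lonely columns (one per piece), generically good. -/
theorem good_node12 : symDet u_node12 e_node12 ≠ 0 :=
  symGood_of_lonely u_node12 (by decide) e_node12 (by decide)

/-- rows of node13 -/
def u_node13 : Fin 1 → Finset (Fin 4) := ![(∅ : Finset (Fin 4))]

/-- columns of node13 -/
def e_node13 : Fin 1 → Fin 1 × Finset (Fin 4) := ![((⟨0, by decide⟩ : Fin 1), ({1, 3} : Finset (Fin 4)))]

/-- leaf node13: lonely columns (one per piece), generically good. -/
theorem good_node13 : symDet u_node13 e_node13 ≠ 0 :=
  symGood_of_lonely u_node13 (by decide) e_node13 (by decide)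

/-- node node11: cut at coordinate 3; deletion side = node12, link side = node13. -/
theorem good_node11 : symDet u_node11 e_node11 ≠ 0 := by
  have h0 : symDet (fun j : Fin 1 => u_node11 (![(0 : Fin 2)] j)) (fun j => e_node11 (![(0 : Fin 2)] j)) ≠ 0 := by
    convert good_node12 using 2
    all_goals (funext j; fin_cases j <;> decide)
  have h1 : symDet (fun j : Fin 1 => (u_node11 (![(1 : Fin 2)] j)).erase (3 : Fin 4)) (fun j => e_node11 (![(1 : Fin 2)] j)) ≠ 0 := by
    convert good_node13 using 2
    all_goals (funext j; fin_cases j <;> decide)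
  refine symGood_of_split_enum u_node11 e_node11 (3 : Fin 4) (fun p => ((![0 ] : Fin 1 → ℤ) p : ℂ))
    (fun p q => ((![![0, 0, 0, -1]] : Fin 1 → Fin 4 → ℤ) p q : ℂ)) (by norm_num) ![(0 : Fin 2)] ![(1 : Fin 2)] ![(0 : Fin 2)] ![(1 : Fin 2)]
    (by decide) (by decide) (by decide) (by decide) ?_ ?_ h0 h1
  · intro j; fin_cases j <;> simp [xi, e_node11, Finset.sum_insert, Finset.sum_pair] <;> norm_num
  · intro j; fin_cases j <;> simp [xi, e_node11, Finset.sum_insert, Finset.sum_pair] <;> norm_num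

/-- rows of node14 -/
def u_node14 : Fin 1 → Finset (Fin 4) := ![(∅ : Finset (Fin 4))]

/-- columns of node14 -/
def e_node14 : Fin 1 → Fin 1 × Finset (Fin 4) := ![((⟨0, by decide⟩ : Fin 1), ({1, 2} : Finset (Fin 4)))]

/-- leaf node14: lonely columns (one per piece), generically good. -/
theorem good_node14 : symDet u_node14 e_node14 ≠ 0 :=
  symGood_of_lonely u_node14 (by decide) e_node14 (by decide)

/-- node node10: cut at coordinate 1; deletion side = node11, link side = node14. -/
theorem good_node10 : symDet u_node10 e_node10 ≠ 0 := by
  have h0 : symDet (fun j : Fin 2 => u_node10 (![(0 : Fin 3), (2 : Fin 3)] j)) (fun j => e_node10 (![(0 : Fin 3), (2 : Fin 3)] j)) ≠ 0 := by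
    convert good_node11 using 2
    all_goals (funext j; fin_cases j <;> decide)
  have h1 : symDet (fun j : Fin 1 => (u_node10 (![(1 : Fin 3)] j)).erase (1 : Fin 4)) (fun j => e_node10 (![(1 : Fin 3)] j)) ≠ 0 := by
    convert good_node14 using 2
    all_goals (funext j; fin_cases j <;> decide)
  refine symGood_of_split_enum u_node10 e_node10 (1 : Fin 4) (fun p => ((![0 ] : Fin 1 → ℤ) p : ℂ))
    (fun p q => ((![![0, 0, -1, 0]] : Fin 1 → Fin 4 → ℤ) p q : ℂ)) (by norm_num) ![(0 : Fin 3), (2 : Fin 3)] ![(1 : Fin 3)] ![(0 : Fin 3), (2 : Fin 3)] ![(1 : Fin 3)]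
    (by decide) (by decide) (by decide) (by decide) ?_ ?_ h0 h1
  · intro j; fin_cases j <;> simp [xi, e_node10, Finset.sum_insert, Finset.sum_pair] <;> norm_num
  · intro j; fin_cases j <;> simp [xi, e_node10, Finset.sum_insert, Finset.sum_pair] <;> norm_num

/-- node node2: cut at coordinate 0; deletion side = node3, link side = node10. -/
theorem good_node2 : symDet u_node2 e_node2 ≠ 0 := by
  have h0 : symDet (fun j : Fin 4 => u_node2 (![(0 : Fin 7), (2 : Fin 7), (4 : Fin 7), (6 : Fin 7)] j)) (fun j => e_node2 (![(0 : Fin 7), (2 : Fin 7), (4 : Fin 7), (6 : Fin 7)] j)) ≠ 0 := by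
    convert good_node3 using 2
    all_goals (funext j; fin_cases j <;> decide)
  have h1 : symDet (fun j : Fin 3 => (u_node2 (![(1 : Fin 7), (3 : Fin 7), (5 : Fin 7)] j)).erase (0 : Fin 4)) (fun j => e_node2 (![(1 : Fin 7), (3 : Fin 7), (5 : Fin 7)] j)) ≠ 0 := by
    convert good_node10 using 2
    all_goals (funext j; fin_cases j <;> decide)
  refine symGood_of_split_enum u_node2 e_node2 (0 : Fin 4) (fun p => ((![0 ] : Fin 1 → ℤ) p : ℂ))
    (fun p q => ((![![0, -1, 0, 0]] : Fin 1 → Fin 4 → ℤ) p q : ℂ)) (by norm_num) ![(0 : Fin 7), (2 : Fin 7), (4 : Fin 7), (6 : Fin 7)] ![(1 : Fin 7), (3 : Fin 7), (5 : Fin 7)] ![(0 : Fin 7), (2 : Fin 7), (4 : Fin 7), (6 : Fin 7)] ![(1 : Fin 7), (3 : Fin 7), (5 : Fin 7)]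
    (by decide) (by decide) (by decide) (by decide) ?_ ?_ h0 h1
  · intro j; fin_cases j <;> simp [xi, e_node2, Finset.sum_insert, Finset.sum_pair] <;> norm_num
  · intro j; fin_cases j <;> simp [xi, e_node2, Finset.sum_insert, Finset.sum_pair] <;> norm_num

/-- rows of node15 -/
def u_node15 : Fin 4 → Finset (Fin 4) := ![(∅ : Finset (Fin 4)), ({0} : Finset (Fin 4)), ({1} : Finset (Fin 4)), ({0, 1} : Finset (Fin 4))]

/-- columns of node15 -/
def e_node15 : Fin 4 → Fin 1 × Finset (Fin 4) := ![((⟨0, by decide⟩ : Fin 1), ({0} : Finset (Fin 4))), ((⟨0, by decide⟩ : Fin 1), ({0, 1} : Finset (Fin 4))), ((⟨0, by decide⟩ : Fin 1), ({0, 2} : Finset (Fin 4))), ((⟨0, by decide⟩ : Fin 1), ({0, 3} : Finset (Fin 4)))]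

/-- rows of node16 -/
def u_node16 : Fin 2 → Finset (Fin 4) := ![(∅ : Finset (Fin 4)), ({1} : Finset (Fin 4))]

/-- columns of node16 -/
def e_node16 : Fin 2 → Fin 1 × Finset (Fin 4) := ![((⟨0, by decide⟩ : Fin 1), ({0} : Finset (Fin 4))), ((⟨0, by decide⟩ : Fin 1), ({0, 3} : Finset (Fin 4)))]

/-- rows of node17 -/
def u_node17 : Fin 1 → Finset (Fin 4) := ![(∅ : Finset (Fin 4))]

/-- columns of node17 -/
def e_node17 : Fin 1 → Fin 1 × Finset (Fin 4) := ![((⟨0, by decide⟩ : Fin 1), ({0} : Finset (Fin 4)))]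

/-- leaf node17: lonely columns (one per piece), generically good. -/
theorem good_node17 : symDet u_node17 e_node17 ≠ 0 :=
  symGood_of_lonely u_node17 (by decide) e_node17 (by decide)

/-- rows of node18 -/
def u_node18 : Fin 1 → Finset (Fin 4) := ![(∅ : Finset (Fin 4))]

/-- columns of node18 -/
def e_node18 : Fin 1 → Fin 1 × Finset (Fin 4) := ![((⟨0, by decide⟩ : Fin 1), ({0, 3} : Finset (Fin 4)))]

/-- leaf node18: lonely columns (one per piece), generically good. -/
theorem good_node18 : symDet u_node18 e_node18 ≠ 0 :=
  symGood_of_lonely u_node18 (by decide) e_node18 (by decide)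

/-- node node16: cut at coordinate 1; deletion side = node17, link side = node18. -/
theorem good_node16 : symDet u_node16 e_node16 ≠ 0 := by
  have h0 : symDet (fun j : Fin 1 => u_node16 (![(0 : Fin 2)] j)) (fun j => e_node16 (![(0 : Fin 2)] j)) ≠ 0 := by
    convert good_node17 using 2
    all_goals (funext j; fin_cases j <;> decide)
  have h1 : symDet (fun j : Fin 1 => (u_node16 (![(1 : Fin 2)] j)).erase (1 : Fin 4)) (fun j => e_node16 (![(1 : Fin 2)] j)) ≠ 0 := by
    convert good_node18 using 2
    all_goals (funext j; fin_cases j <;> decide)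
  refine symGood_of_split_enum u_node16 e_node16 (1 : Fin 4) (fun p => ((![0 ] : Fin 1 → ℤ) p : ℂ))
    (fun p q => ((![![0, 0, 0, -1]] : Fin 1 → Fin 4 → ℤ) p q : ℂ)) (by norm_num) ![(0 : Fin 2)] ![(1 : Fin 2)] ![(0 : Fin 2)] ![(1 : Fin 2)]
    (by decide) (by decide) (by decide) (by decide) ?_ ?_ h0 h1
  · intro j; fin_cases j <;> simp [xi, e_node16, Finset.sum_insert, Finset.sum_pair] <;> norm_num
  · intro j; fin_cases j <;> simp [xi, e_node16, Finset.sum_insert, Finset.sum_pair] <;> norm_num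

/-- rows of node19 -/
def u_node19 : Fin 2 → Finset (Fin 4) := ![(∅ : Finset (Fin 4)), ({1} : Finset (Fin 4))]

/-- columns of node19 -/
def e_node19 : Fin 2 → Fin 1 × Finset (Fin 4) := ![((⟨0, by decide⟩ : Fin 1), ({0, 1} : Finset (Fin 4))), ((⟨0, by decide⟩ : Fin 1), ({0, 2} : Finset (Fin 4)))]

/-- rows of node20 -/
def u_node20 : Fin 1 → Finset (Fin 4) := ![(∅ : Finset (Fin 4))]

/-- columns of node20 -/
def e_node20 : Fin 1 → Fin 1 × Finset (Fin 4) := ![((⟨0, by decide⟩ : Fin 1), ({0, 2} : Finset (Fin 4)))]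

/-- leaf node20: lonely columns (one per piece), generically good. -/
theorem good_node20 : symDet u_node20 e_node20 ≠ 0 :=
  symGood_of_lonely u_node20 (by decide) e_node20 (by decide)

/-- rows of node21 -/
def u_node21 : Fin 1 → Finset (Fin 4) := ![(∅ : Finset (Fin 4))]

/-- columns of node21 -/
def e_node21 : Fin 1 → Fin 1 × Finset (Fin 4) := ![((⟨0, by decide⟩ : Fin 1), ({0, 1} : Finset (Fin 4)))]

/-- leaf node21: lonely columns (one per piece), generically good. -/
theorem good_node21 : symDet u_node21 e_node21 ≠ 0 :=
  symGood_of_lonely u_node21 (by decide) e_node21 (by decide)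

/-- node node19: cut at coordinate 1; deletion side = node20, link side = node21. -/
theorem good_node19 : symDet u_node19 e_node19 ≠ 0 := by
  have h0 : symDet (fun j : Fin 1 => u_node19 (![(0 : Fin 2)] j)) (fun j => e_node19 (![(1 : Fin 2)] j)) ≠ 0 := by
    convert good_node20 using 2
    all_goals (funext j; fin_cases j <;> decide)
  have h1 : symDet (fun j : Fin 1 => (u_node19 (![(1 : Fin 2)] j)).erase (1 : Fin 4)) (fun j => e_node19 (![(0 : Fin 2)] j)) ≠ 0 := by
    convert good_node21 using 2
    all_goals (funext j; fin_cases j <;> decide)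
  refine symGood_of_split_enum u_node19 e_node19 (1 : Fin 4) (fun p => ((![0 ] : Fin 1 → ℤ) p : ℂ))
    (fun p q => ((![![0, -1, 0, 0]] : Fin 1 → Fin 4 → ℤ) p q : ℂ)) (by norm_num) ![(0 : Fin 2)] ![(1 : Fin 2)] ![(1 : Fin 2)] ![(0 : Fin 2)]
    (by decide) (by decide) (by decide) (by decide) ?_ ?_ h0 h1
  · intro j; fin_cases j <;> simp [xi, e_node19, Finset.sum_insert, Finset.sum_pair] <;> norm_num
  · intro j; fin_cases j <;> simp [xi, e_node19, Finset.sum_insert, Finset.sum_pair] <;> norm_num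

/-- node node15: cut at coordinate 0; deletion side = node16, link side = node19. -/
theorem good_node15 : symDet u_node15 e_node15 ≠ 0 := by
  have h0 : symDet (fun j : Fin 2 => u_node15 (![(0 : Fin 4), (2 : Fin 4)] j)) (fun j => e_node15 (![(0 : Fin 4), (3 : Fin 4)] j)) ≠ 0 := by
    convert good_node16 using 2
    all_goals (funext j; fin_cases j <;> decide)
  have h1 : symDet (fun j : Fin 2 => (u_node15 (![(1 : Fin 4), (3 : Fin 4)] j)).erase (0 : Fin 4)) (fun j => e_node15 (![(1 : Fin 4), (2 : Fin 4)] j)) ≠ 0 := by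
    convert good_node19 using 2
    all_goals (funext j; fin_cases j <;> decide)
  refine symGood_of_split_enum u_node15 e_node15 (0 : Fin 4) (fun p => ((![0 ] : Fin 1 → ℤ) p : ℂ))
    (fun p q => ((![![0, 1, -1, 0]] : Fin 1 → Fin 4 → ℤ) p q : ℂ)) (by norm_num) ![(0 : Fin 4), (2 : Fin 4)] ![(1 : Fin 4), (3 : Fin 4)] ![(0 : Fin 4), (3 : Fin 4)] ![(1 : Fin 4), (2 : Fin 4)]
    (by decide) (by decide) (by decide) (by decide) ?_ ?_ h0 h1
  · intro j; fin_cases j <;> simp [xi, e_node15, Finset.sum_insert, Finset.sum_pair] <;> norm_num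
  · intro j; fin_cases j <;> simp [xi, e_node15, Finset.sum_insert, Finset.sum_pair] <;> norm_num

/-- node node1: cut at coordinate 2; deletion side = node2, link side = node15. -/
theorem good_node1 : symDet u_node1 e_node1 ≠ 0 := by
  have h0 : symDet (fun j : Fin 7 => u_node1 (![(0 : Fin 11), (1 : Fin 11), (2 : Fin 11), (3 : Fin 11), (8 : Fin 11), (9 : Fin 11), (10 : Fin 11)] j)) (fun j => e_node1 (![(0 : Fin 11), (2 : Fin 11), (4 : Fin 11), (6 : Fin 11), (7 : Fin 11), (9 : Fin 11), (10 : Fin 11)] j)) ≠ 0 := by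
    convert good_node2 using 2
    all_goals (funext j; fin_cases j <;> decide)
  have h1 : symDet (fun j : Fin 4 => (u_node1 (![(4 : Fin 11), (5 : Fin 11), (6 : Fin 11), (7 : Fin 11)] j)).erase (2 : Fin 4)) (fun j => e_node1 (![(1 : Fin 11), (3 : Fin 11), (5 : Fin 11), (8 : Fin 11)] j)) ≠ 0 := by
    convert good_node15 using 2
    all_goals (funext j; fin_cases j <;> decide)
  refine symGood_of_split_enum u_node1 e_node1 (2 : Fin 4) (fun p => ((![0 ] : Fin 1 → ℤ) p : ℂ))
    (fun p q => ((![![-1, 0, 0, 0]] : Fin 1 → Fin 4 → ℤ) p q : ℂ)) (by norm_num) ![(0 : Fin 11), (1 : Fin 11), (2 : Fin 11), (3 : Fin 11), (8 : Fin 11), (9 : Fin 11), (10 : Fin 11)] ![(4 : Fin 11), (5 : Fin 11), (6 : Fin 11), (7 : Fin 11)] ![(0 : Fin 11), (2 : Fin 11), (4 : Fin 11), (6 : Fin 11), (7 : Fin 11), (9 : Fin 11), (10 : Fin 11)] ![(1 : Fin 11), (3 : Fin 11), (5 : Fin 11), (8 : Fin 11)]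
    (by decide) (by decide) (by decide) (by decide) ?_ ?_ h0 h1
  · intro j; fin_cases j <;> simp [xi, e_node1, Finset.sum_insert, Finset.sum_pair] <;> norm_num
  · intro j; fin_cases j <;> simp [xi, e_node1, Finset.sum_insert, Finset.sum_pair] <;> norm_num
/-- The certified instance: some complex table makes the block-additive matrix of (u_node1, e_node1) nonsingular. -/
theorem certified : ∃ tx : Fin 1 → Option (Fin 4) → Fin 4 → ℂ,
    (Matrix.of fun i k : Fin 11 =>
      ∏ a ∈ u_node1 i, (tx (e_node1 k).1 none a + ∑ q ∈ (e_node1 k).2, tx (e_node1 k).1 (some q) a)).det ≠ 0 :=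
  exists_table_of_symDet_ne_zero u_node1 e_node1 good_node1

end

end Summit.ValiantsHypothesis.ValiantsHypothesis.Theorems.BarrierLever.HiddenStates.SymbJoin.Cert
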